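import Literature.NumberTheory.DiophantineGeometry.ApproximationBoundRat
import Literature.NumberTheory.DiophantineGeometry.ApproximationBoundRatPadicCaseAProofs
import HarnessLib

/-!
# The `p`-adic approximation bound over `ℚ` ("A1.L(p)") from a `p`-adic linear-forms bound for
# dependent rational `p`-adic units in SHAPE form (Evertse–Győry §4.4.2 at `α = 1`)

Topic `NumberTheory/DiophantineGeometry`; namespace `Literature.NumberTheory.DiophantineGeometry.Dioph`.
Proofs only: no definition, no named fact. Third of three companion files.

`padicApproximationBound_rat` (`ApproximationBoundRat.lean`; Pasten 2024 Thm 2.1 (ii), `d = 1`,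
constant existential) is derived here (`padicApproximationBound_rat_of_depCore`) from ONE
hypothesis in shape form, uniform in the prime `p`: a `p`-adic linear-forms bound for rational
`p`-adic units `αₖ ∉ {0, ±1}` (congruent to `1 mod 8` when `p = 2`), NOT assumed multiplicatively
independent, exponents `|bₖ| ≤ B` (`B ≥ 3`), `∏ αₖ^{bₖ} ≠ 1`, with conclusion
`ord_p(∏ αₖ^{bₖ} − 1) · log p ≤ Cⁿ · (p / log p) · ∏ h(αₖ) · (log B + log p + ∑ log(3 h(αₖ)) + 2n)`
(`n` = number of `αₖ`; plain heights as weights; the log slot is additive in the `log h(αₖ)` so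
that the elimination of multiplicative relations is an induction with a uniform constant). The
reduction is Evertse–Győry's proof of Thm 4.2.1 (pp. 80–81) at `K = ℚ`, `α = 1` (`H = 1`): a
height-minimal system with small exponents (`exists_small_exponents` = Prop 4.4.1, proved in the
tree), Case B by the Liouville inequality (`liouville_finite`, `eg421_caseB_bound`), Case A by
`caseA_padic_bound`; at `α = 1` the logarithm is `≤ 16^m log max(e, p h(x))` — no `δ/Bₙ`
refinement of Yu's theorem is needed (cell `abc-stewartyu`, AFTER-M3 brief §3.1, kill test (i)).
Constant `K := max(pastenK, 32C/log 2 + 1)`.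

## References

* [EvertseGyory2015] J.-H. Evertse, K. Győry, *Unit Equations in Diophantine Number Theory*,
  CUP 2015 — Thm 4.2.1 (p. 68), proof §4.4.2 (pp. 80–81), Prop 4.4.1.
* [Pasten2024] H. Pasten, *The largest prime factor of `n² + 1` and improvements on subexponential
  ABC*, Invent. Math. 236 (2024) — Theorem 2.1 (ii) with `d = 1`.
-/

noncomputable section

open Finset Real Height

namespace Literature.NumberTheory.DiophantineGeometry.Dioph

/-! ### Elementary lemmas -/

/-- `ord_p 2 · log p ≤ log 2` for a prime `p` (equality at `p = 2`, zero otherwise). [folklore] -/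
private theorem padicValRat_two_mul_log_le {p : ℕ} (hp : p.Prime) :
    (padicValRat p (2 : ℚ) : ℝ) * Real.log p ≤ Real.log 2 := by
  have h2 : ((2 : ℕ) : ℚ) = (2 : ℚ) := by norm_num
  rw [← h2, padicValRat.of_nat]
  by_cases hp2 : p = 2
  · subst hp2
    haveI : Fact (Nat.Prime 2) := ⟨Nat.prime_two⟩
    rw [padicValNat_self]; push_cast; simp
  · haveI : Fact (Nat.Prime 2) := ⟨Nat.prime_two⟩
    haveI : Fact p.Prime := ⟨hp⟩
    rw [padicValNat_primes hp2]; push_cast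
    rw [zero_mul]; exact Real.log_nonneg one_le_two

/-- If `ord_p(1 − x) ≥ 1` then `x` is a `p`-adic unit. [folklore] -/
private theorem padicValRat_eq_zero_of_one_le {p : ℕ} [Fact p.Prime] {x : ℚ} (hx : x ≠ 0) (hx1 : x ≠ 1)
    (hv : 1 ≤ padicValRat p (1 - x)) : padicValRat p x = 0 := by
  by_contra h
  have h1 : x - 1 ≠ 0 := sub_ne_zero.mpr hx1
  have h2 := Literature.Barriers.ABC.padicValRat_sub_one_nonpos_of_ne_zero hx h1 h
  rw [← neg_sub, padicValRat.neg] at hv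
  linarith

/-- `2 ≤ pastenK` (crude). [folklore] -/
private theorem two_le_pastenK : 2 ≤ pastenK := by
  rw [pastenK_def]
  have h1 : (1 : ℝ) ≤ 16 * Real.exp 1 := by
    have := Real.add_one_le_exp (1 : ℝ); nlinarith
  have h2 : (1 : ℝ) ≤ (16 * Real.exp 1) ^ 8 := one_le_pow₀ h1
  nlinarith

/-! ### The `p`-adic half from the dependent core -/

/-- **The `p`-adic approximation bound over `ℚ` ("A1.L(p)", `padicApproximationBound_rat`:
Pasten 2024 Thm 2.1 (ii), `d = 1`, constant existential) from a `p`-adic linear-forms bound in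
SHAPE form for DEPENDENT rational `p`-adic units, uniform in `p`.** The hypothesis `hdep`: for
every prime `p`, every finite family of rational `p`-adic units `αₖ ∉ {0, 1, −1}` (congruent to
`1 mod 8` if `p = 2`), exponents `|bₖ| ≤ B`, `B ≥ 3`, `∏ αₖ^{bₖ} ≠ 1`:
`ord_p(∏ αₖ^{bₖ} − 1)·log p ≤ Cⁿ·(p/log p)·∏ h(αₖ)·(log B + log p + ∑ log(3h(αₖ)) + 2n)`.
Proof = Evertse–Győry §4.4.2 at `K = ℚ`, `α = 1`: small exponents (`exists_small_exponents`),
Case B by Liouville (`liouville_finite`, `eg421_caseB_bound`, constant `pastenK`), Case A by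
`caseA_padic_bound`; `K := max(pastenK, 32C/log 2 + 1)`.
[cite: EvertseGyory2015, Thm 4.2.1 (p. 68), proof pp. 80–81] [cite: Pasten2024, Theorem 2.1 (ii) (d = 1)] -/
theorem padicApproximationBound_rat_of_depCore {C : ℝ} (hC : 1 ≤ C)
    (hdep : ∀ (p : ℕ), p.Prime → ∀ (κ : Type) [Fintype κ] [DecidableEq κ] (α : κ → ℚ)
      (b : κ → ℤ) (B : ℝ),
      (∀ k, α k ≠ 0) → (∀ k, padicValRat p (α k) = 0) → (∀ k, α k ≠ 1) → (∀ k, α k ≠ -1) →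
      (p = 2 → ∀ k, 3 ≤ padicValRat 2 (α k - 1)) →
      (∀ k, (|b k| : ℝ) ≤ B) → 3 ≤ B → ∏ k, α k ^ b k ≠ 1 →
      (padicValRat p (∏ k, α k ^ b k - 1) : ℝ) * Real.log p ≤
        C ^ Fintype.card κ * (p / Real.log p) * (∏ k, logHeight₁ (α k)) *
          (Real.log B + Real.log p + ∑ k, Real.log (3 * logHeight₁ (α k)) +
            2 * Fintype.card κ)) :
    padicApproximationBound_rat := by
  classical
  set K := max pastenK (32 * C / Real.log 2 + 1) with hK
  have hK1 : 1 ≤ K := le_max_of_le_left one_le_pastenK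
  have hK2 : 2 ≤ K := le_max_of_le_left two_le_pastenK
  refine ⟨K, hK1, fun ι _ hι ξ hξ ζ hζ b hne p hp => ?_⟩
  haveI := Fact.mk hp
  obtain ⟨ξ', ζ', b', hξ', hζ', hxeq, hΘle, hb'⟩ := exists_small_exponents hι ξ hξ ζ hζ b
  set m := Fintype.card ι with hm
  set x : ℚ := ζ * ∏ i, ξ i ^ b i with hxdef
  set Θ := ∏ i, logHeight₁ (ξ i) with hΘ
  set Θ' := ∏ i, logHeight₁ (ξ' i) with hΘ'
  set L := Real.log (max (Real.exp 1) (p * logHeight₁ x)) with hL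
  have hl2 : 0 < Real.log 2 := Real.log_pos one_lt_two
  have hp1 : (1 : ℝ) < p := by exact_mod_cast hp.one_lt
  have hlogp : 0 < Real.log p := Real.log_pos hp1
  have hkp : Real.exp 1 ≤ p / Real.log p := exp_one_le_div_log hp1
  have he0 : 0 < Real.exp 1 := Real.exp_pos 1
  have hpdiv : 0 < (p : ℝ) / Real.log p := lt_of_lt_of_le he0 hkp
  have hL1 : 1 ≤ L := by
    rw [hL, ← Real.log_exp 1]
    exact Real.log_le_log (Real.exp_pos 1) (by rw [Real.log_exp]; exact le_max_left _ _)
  have hΘlow : Real.log 2 ^ m ≤ Θ := by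
    have : ∏ _i : ι, Real.log 2 = Real.log 2 ^ m := by rw [Finset.prod_const, Finset.card_univ]
    rw [← this]
    exact Finset.prod_le_prod (fun i _ => hl2.le) fun i _ =>
      log_two_le_logHeight₁ (hξ i).1 (hξ i).2.1 (hξ i).2.2
  have hΘpos : 0 < Θ := lt_of_lt_of_le (pow_pos hl2 m) hΘlow
  have hKm : 0 < K ^ m := pow_pos (by linarith) m
  have hRHS : 0 < K ^ m * (p / Real.log p) * L * Θ := by positivity
  -- a lower bound for the right-hand side used twice: `RHS ≥ e`
  have hRHSe : Real.exp 1 ≤ K ^ m * (p / Real.log p) * L * Θ := by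
    have h1 : (1 : ℝ) ≤ K ^ m * Θ := by
      have h2 : (1 : ℝ) ≤ (K * Real.log 2) ^ m := by
        apply one_le_pow₀
        have : (2 : ℝ) * Real.log 2 ≤ K * Real.log 2 := mul_le_mul_of_nonneg_right hK2 hl2.le
        linarith [Literature.Barriers.ABC.one_le_two_mul_log_two]
      calc (1 : ℝ) ≤ (K * Real.log 2) ^ m := h2
        _ = K ^ m * Real.log 2 ^ m := mul_pow _ _ _
        _ ≤ K ^ m * Θ := mul_le_mul_of_nonneg_left hΘlow hKm.le
    calc Real.exp 1 = 1 * Real.exp 1 * 1 := by ring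
      _ ≤ (K ^ m * Θ) * (p / Real.log p) * L :=
          mul_le_mul (mul_le_mul h1 hkp he0.le (by positivity)) hL1 zero_le_one (by positivity)
      _ = K ^ m * (p / Real.log p) * L * Θ := by ring
  have hx1 : x ≠ 1 := hne
  -- Step 0: the bound is trivial unless `ord_p(1 - x) ≥ 1`
  by_cases hv : padicValRat p (1 - x) ≤ 0
  · have h1 : (padicValRat p (1 - x) : ℝ) ≤ 0 := by exact_mod_cast hv
    have h2 : (padicValRat p (1 - x) : ℝ) * Real.log p ≤ 0 :=
      mul_nonpos_of_nonpos_of_nonneg h1 hlogp.le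
    linarith
  have hv1 : 1 ≤ padicValRat p (1 - x) := by push Not at hv; omega
  have hζ0 : ζ ≠ 0 := by rcases hζ with rfl | rfl <;> norm_num
  have hx0 : x ≠ 0 :=
    mul_ne_zero hζ0 (Finset.prod_ne_zero_iff.mpr fun i _ => zpow_ne_zero _ (hξ i).1)
  -- `x = -1`: `ord_p 2 · log p ≤ log 2 < e ≤ RHS`
  by_cases hx2 : x = -1
  · have h1 : (padicValRat p (1 - x) : ℝ) * Real.log p ≤ Real.log 2 := by
      rw [hx2, show (1 : ℚ) - -1 = 2 by norm_num]; exact padicValRat_two_mul_log_le hp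
    have h2 : Real.log 2 < Real.exp 1 := by
      have := Real.log_two_lt_d9; have := Real.exp_one_gt_d9; linarith
    have h3 : logHeight₁ x = 0 := by rw [hx2, logHeight₁_neg, logHeight₁_one]
    have hL' : L = 1 := by
      rw [hL, h3, mul_zero, max_eq_left (Real.exp_pos 1).le, Real.log_exp]
    rw [hL', mul_one] at hRHSe
    rw [hL', mul_one]
    linarith
  have hvx : padicValRat p x = 0 := padicValRat_eq_zero_of_one_le hx0 hx1 hv1
  set B₀ : ℝ := (m : ℝ) ^ (2 * m) * logHeight₁ x / Real.log 2 with hB₀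
  by_cases hcase : 2 * Real.exp 1 * 9 ^ (m + 1) * Θ' ≤ B₀
  · -- Case A
    obtain ⟨n, hn⟩ : ∃ n, Fintype.card ι = n + 1 := ⟨m - 1, by omega⟩
    have hA := caseA_padic_bound hC (hdep p hp) hn ξ' hξ' ζ' hζ' b' hxeq hx1 hx2 hvx hB₀ hb'
      hcase
    have hlt : (32 * C / Real.log 2) ^ m < K ^ m := by
      apply pow_lt_pow_left₀ _ (by positivity) (by omega)
      calc 32 * C / Real.log 2 < 32 * C / Real.log 2 + 1 := lt_add_one _
        _ ≤ K := le_max_right _ _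
    have hpos : 0 < (p : ℝ) / Real.log p * L * Θ := by positivity
    have hΘ'0 : 0 ≤ Θ' := Finset.prod_nonneg fun i _ => zero_le_logHeight₁ _
    calc (padicValRat p (1 - x) : ℝ) * Real.log p
        ≤ (32 * C / Real.log 2) ^ m * (p / Real.log p) * L * Θ' := hA
      _ ≤ (32 * C / Real.log 2) ^ m * (p / Real.log p) * L * Θ := by
          apply mul_le_mul_of_nonneg_left hΘle; positivity
      _ = (32 * C / Real.log 2) ^ m * ((p / Real.log p) * L * Θ) := by ring
      _ < K ^ m * ((p / Real.log p) * L * Θ) := mul_lt_mul_of_pos_right hlt hpos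
      _ = K ^ m * (p / Real.log p) * L * Θ := by ring
  · -- Case B: Liouville
    push Not at hcase
    have hm1 : (1 : ℝ) ≤ m := by exact_mod_cast hι
    have hhx0 : 0 ≤ logHeight₁ x := zero_le_logHeight₁ _
    have hxB : logHeight₁ x ≤ B₀ := by
      rw [hB₀, le_div_iff₀ hl2]
      have h1 : (1 : ℝ) ≤ (m : ℝ) ^ (2 * m) := one_le_pow₀ hm1
      have hl2' : Real.log 2 ≤ 1 := by linarith [Real.log_two_lt_d9]
      nlinarith
    have hΘ'Θ : 2 * Real.exp 1 * 9 ^ (m + 1) * Θ' ≤ 2 * Real.exp 1 * 9 ^ (m + 1) * Θ :=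
      mul_le_mul_of_nonneg_left hΘle (by positivity)
    have ht : Real.log 2 + logHeight₁ x <
        Real.log 2 + 1 + 2 * Real.exp 1 * 9 ^ (m + 1) * Θ * 1 := by linarith
    have h1 := liouville_finite hx1 p hp
    have h2 := eg421_caseB_bound m hι (k := p / Real.log p) (L := L) (H := 1) hΘlow le_rfl hkp
      hL1 ht
    have hc8 : egC8 m ≤ K ^ m := by
      have h5 := five_mul_egC8_le m hι
      have h0 := egC8_nonneg m
      have hKK : pastenK ^ m ≤ K ^ m :=
        pow_le_pow_left₀ (le_trans zero_le_one one_le_pastenK) (le_max_left _ _) m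
      linarith
    have h3 : egC8 m * (p / Real.log p) * Θ * 1 * L ≤ K ^ m * (p / Real.log p) * L * Θ := by
      have : egC8 m * (p / Real.log p) * Θ * 1 * L = egC8 m * ((p / Real.log p) * L * Θ) := by
        ring
      rw [this, show K ^ m * (p / Real.log p) * L * Θ = K ^ m * ((p / Real.log p) * L * Θ) by
        ring]
      exact mul_le_mul_of_nonneg_right hc8 (by positivity)
    linarith

end Literature.NumberTheory.DiophantineGeometry.Dioph

end
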